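import Summits.QuantumFields.YangMills.Theorems.UnitScaleTiltHalvingP1FlatCoreSupplierGaugeDescent
import Summits.QuantumFields.YangMills.Theorems.UnitScaleTiltHalvingP1FlatCoreTopSizesChart
import Summits.QuantumFields.YangMills.Theorems.UnitScaleTiltHalvingP1FlatCoreTopTargetRep
import Literature.MathematicalPhysics.QuantumFieldTheory.Balaban1983to89.B8CubeMemberZd
import HarnessLib

/-!
# `hP1room` PROGRAMME (LEAD-H «H = hSupUρ3 ⟸ hSiteRows», (K-knit)): ★★ THE TOP-KNIT CLAUSE OF THE GAUGE-FIXED DATUM FIELD AT THE TORUS MEMBER — the `hknit` row of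
# ✓p654113 `HalvingHSiteSizeRowsOfTopRows.siteSizeRows_of_topRows` in ✓p645668 `P1FlatCoreTopH42.H42_top_guarded`'s letters, from ✓p645686's window-local descent

Route `UnitScaleTilt`, crux K1 child «MinimiserStabilityRegPr» (stmt-QuantumFields-19200), registered stub `stub_halvingStep` (`BirthV10`).  Cell `ym3-torus` (HUMAN RULING
D-0037: YM₃ on T³ is ladder rung R3 — NOT d = 4, NOT a mass gap, NOT the Clay problem), width seat `ym-ust-20520-w3` gen 6.  `--supports stmt-QuantumFields-19200 --as helper`;
THEOREMS ONLY (0 `def`, 0 `sorry`); count-neutral; nothing here claims `core′`, `hP1room(ρ3)`, `hSupU(ρ3)`, the stub, the crux or the gap.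

WHAT.  ✓p654113 reads the two Prop-3 sockets at `Lan k V := IsLandau138W … V ∧ Q V` with an abstract top-knit clause `Q` and displays `hknit : Q (W^{λ′})`, `W^{λ′} := mgauge 1
(gaugeExp λ′)⁻¹ W` (the gauge-fixed DATUM field).  ✓p645668 `H42_top_guarded` consumes `Lan` through «`Lan k W → ∀ c ∈ Λb k, ∀ y τ, y, y + e_τ ∈ bondbox_k(c) → W y τ =
Wf ⟨cover y, τ⟩`» for a torus field `Wf`.  HERE, at the torus member (site `x₀`, window `(a, M′, ρ′)`, N05's top tower-bond family `cubeLamB L a M′ ρ′ k k k`):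
★★ `hknit_of_descent` — with `Wf := (U♯)^{g′}` for the COMPOSITE gauge of the FULL gauge `u₁·e^{iλ′}`, `g′ s := ((u₁ * gaugeExp λ′) (lift x₀ + rel x₀ s))⁻¹ * toUnits (suIncl
(gJ s))`, the clause holds: `W^{λ′} y τ = (U♯)^{g′} ⟨cover y, τ⟩` for every bond of every top block's box — by ✓p645686 `gaugeActT_descent_eq_of_mgauge` at the gauge `u₁·e^{iλ′}`
RE-PROVED ON ALL OF N05's `□₀` (§1 ★`gaugeActT_descent_eq_of_mgauge_cube`: both bond ends in `□₀` suffice — the representative identity ✓p642293 `rep_cover_eq_of_mem_cube` holds on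
`□₀` under the room `hroomW`, no route-window premise; LEAD-H 17:52Z reshape), its `hWV` by ✓p645427 `datumGuards_gaugeFixed` (`mgauge 1 (u₁·e^{iλ′}) W^{λ′} = U′ = pull (U^{gJ})♯ 0`),
and the top blocks' bond boxes lying in `□_k ⊆ □₀` (lit ✓`hbox_cubeLamB`, ✓`cube_anti`).  NOTHING DISPLAYED beyond the door's window letters `ha hroomW`.  So (K-final) instantiates
✓p654113's `Q` with ✓p645668's clause at this `Wf` and feeds `hknit := hknit_of_descent …`; ✓p645668's `hLan` is then `fun W h => h.2`.  HONEST SCOPE: an identity; ✓p645668's other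
torus inputs (`hWf1 r`, `htop t`, `hwin`) are the (h2) author's rows, not touched here.

References: T. Bałaban, CMP **99** (1985) 75–102 [Balaban1985RegularSpaces] ((1.42) p.83, (1.69) p.88, (1.131) p.99); CMP **102** (1985) 277–309 [Balaban1985Variational] ((152) p.301).
-/

set_option autoImplicit false

noncomputable section

open scoped BigOperators Matrix.Norms.L2Operator
open NormedSpace
open Complex (I)

namespace Summit.QuantumFields.YangMills.Theorems.HalvingHSiteTopKnit

open Literature.MathematicalPhysics.QuantumFieldTheory.Balaban1983to89
open Literature.MathematicalPhysics.QuantumFieldTheory.Balaban1983to89.T3ContinuumYM3Torus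
open B5Eq118OneStroke (iterBlockOf)
open B7Prop1Explicit renaming Site → LSite
open B7Prop1Explicit (e)
open B7Prop2Explicit (unitaryUnits)
open B7Prop1Local (InBox loK bondHiK)
open B7Eq92Concrete (mgauge)
open B8Eq131Cubes (cube gs cube_anti)
open B8Eq131CubesAdmissible (cubeFam cubeFam_false_of_le)
open B8CubeMemberZd (cubeLamB hbox_cubeLamB)
open B8Eq184Proof (gaugeExp)
open B10Eq27TorusAxialLog (transl transl_add_e rel pull unitsField toUField suIncl gaugeActT)
open B15Eq112TorusCover (lift cover)
open P1FlatCoreCubeInclusion (transl_zero_eq_cover)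
open P1FlatCoreTopTargetRep (rep_cover_eq_of_mem_cube)
open HalvingCompetitorMapFibre (unitsField_toUField_gaugeAct)
open B7Eq92Concrete (mgauge_apply Rc_one_apply)
open B10Eq27TorusAxialLog (pull_apply)
open HalvingP1FlatCoreSupplierGaugeDescent (gaugeActT_mul_left)
open Summit.QuantumFields.YangMills.Theorems (FlatMinimizerH.le_T3)
open HalvingP1FlatCoreTopSizes (datumGuards_gaugeFixed)

variable {F : T3Family} {n K : ℕ}

/-- ★ **THE COMPOSITE GAUGE READS THEOREM 4's GAUGE-FIXED FIELD ON ALL OF `□₀`** — ✓p645686 `gaugeActT_descent_eq_of_mgauge` with the two route-window premises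
REPLACED by `z, z + e_ν ∈ □₀` (the representatives by ✓p642293 `rep_cover_eq_of_mem_cube`, which needs only the room): `(U♯)^{g}⟨0+z, ν⟩ = W z ν`.
[cite: Balaban1985RegularSpaces, (1.68)-(1.69) p.88, (1.131) p.99; Balaban1985Variational, (152) p.301] -/
theorem gaugeActT_descent_eq_of_mgauge_cube (x₀ : Site (F.P K) 0) {a : LSite (F.P K).d} {M' ρ' : ℕ}
    (ha : ∀ ν, a ν ≤ ((iterBlockOf (K - n) x₀ ν).val : ℤ) ∧ ((iterBlockOf (K - n) x₀ ν).val : ℤ) ≤ a ν + M' - 1)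
    (hroomW : 2 * ((F.P K).L ^ (K - n) * (M' + 1) + ρ' * gs (F.P K).L (K - n)) ≤ (F.P K).sitesPerDir 0)
    (U : GaugeField (F.P K) 0 (Matrix.specialUnitaryGroup (Fin 2) ℂ)) (gJ : GaugeTransf (F.P K) 0 (Matrix.specialUnitaryGroup (Fin 2) ℂ))
    (u₁ : LSite (F.P K).d → (Matrix (Fin 2) (Fin 2) ℂ)ˣ) (W : LSite (F.P K).d → Fin (F.P K).d → (Matrix (Fin 2) (Fin 2) ℂ)ˣ)
    (hWV : mgauge (1 : LSite (F.P K).d → Fin (F.P K).d → (Matrix (Fin 2) (Fin 2) ℂ)ˣ) u₁ W =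
      pull (unitsField (toUField (GaugeField.gaugeAct gJ U))) 0)
    {z : LSite (F.P K).d} (hz : z ∈ cube (F.P K).L a M' ρ' (K - n) 0) (ν : Fin (F.P K).d) (hzν : z + e ν ∈ cube (F.P K).L a M' ρ' (K - n) 0) :
    gaugeActT (fun s => (u₁ (lift (F.P K) x₀ + rel x₀ s))⁻¹ * Unitary.toUnits (suIncl (gJ s)) : GaugeTransf (F.P K) 0 (Matrix (Fin 2) (Fin 2) ℂ)ˣ)
        (unitsField (toUField U)) ⟨transl 0 z, ν⟩ = W z ν := by
  have hk : K - n ≤ (F.P K).m + (F.P K).K := FlatMinimizerH.le_T3 F n K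
  have hz1 : lift (F.P K) x₀ + rel x₀ (transl (0 : Site (F.P K) 0) z) = z := by
    rw [transl_zero_eq_cover]; exact rep_cover_eq_of_mem_cube hk x₀ ha hroomW hz
  have hz2 : lift (F.P K) x₀ + rel x₀ ((transl (0 : Site (F.P K) 0) z).shift ν) = z + e ν := by
    rw [← transl_add_e, transl_zero_eq_cover]; exact rep_cover_eq_of_mem_cube hk x₀ ha hroomW hzν
  have hwin : gaugeActT (fun s => (u₁ (lift (F.P K) x₀ + rel x₀ s))⁻¹ * Unitary.toUnits (suIncl (gJ s)) : GaugeTransf (F.P K) 0 (Matrix (Fin 2) (Fin 2) ℂ)ˣ)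
        (unitsField (toUField U)) ⟨transl 0 z, ν⟩ =
      (u₁ z)⁻¹ * gaugeActT (fun s => Unitary.toUnits (suIncl (gJ s))) (unitsField (toUField U)) ⟨transl 0 z, ν⟩ * u₁ (z + e ν) := by
    rw [gaugeActT_mul_left (fun s => (u₁ (lift (F.P K) x₀ + rel x₀ s))⁻¹) (fun s => Unitary.toUnits (suIncl (gJ s))) (unitsField (toUField U)) ⟨transl 0 z, ν⟩]
    simp only [PBond.tgt, hz1, hz2, inv_inv]
  rw [hwin, ← unitsField_toUField_gaugeAct, ← pull_apply (unitsField (toUField (GaugeField.gaugeAct gJ U))) 0 z ν, ← hWV, mgauge_apply, Pi.one_apply,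
    Pi.one_apply, Rc_one_apply]
  group

/-- ★★ **THE TOP-KNIT CLAUSE OF THE GAUGE-FIXED DATUM FIELD AT THE TORUS MEMBER** — see the module docstring: on every bond of every top block's box,
`W^{λ′} y τ = (U♯)^{g′} ⟨cover y, τ⟩` for the composite `g′` of the full gauge `u₁·e^{iλ′}` (✓p645668 `H42_top_guarded`'s knit clause, = the `hknit` row of ✓p654113 at that `Q`);
nothing displayed beyond the window letters `ha hroomW`. [cite: Balaban1985RegularSpaces, (1.42) p.83, (1.69) p.88, (1.131) p.99; Balaban1985Variational, (152) p.301] -/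
theorem hknit_of_descent (x₀ : Site (F.P K) 0) {a : LSite (F.P K).d} {M' ρ' : ℕ}
    (ha : ∀ ν, a ν ≤ ((iterBlockOf (K - n) x₀ ν).val : ℤ) ∧ ((iterBlockOf (K - n) x₀ ν).val : ℤ) ≤ a ν + M' - 1)
    (hroomW : 2 * ((F.P K).L ^ (K - n) * (M' + 1) + ρ' * gs (F.P K).L (K - n)) ≤ (F.P K).sitesPerDir 0)
    (U : GaugeField (F.P K) 0 (Matrix.specialUnitaryGroup (Fin 2) ℂ)) (gJ : GaugeTransf (F.P K) 0 (Matrix.specialUnitaryGroup (Fin 2) ℂ))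
    -- Theorem 4's datum `(u₁, W)` with `W^{u₁} = U′ := pull (U^{gJ})♯ 0`, and the top step's self-adjoint `λ′`
    {u₁ : LSite (F.P K).d → (Matrix (Fin 2) (Fin 2) ℂ)ˣ} {W : LSite (F.P K).d → Fin (F.P K).d → (Matrix (Fin 2) (Fin 2) ℂ)ˣ}
    (hu₁ : ∀ x, u₁ x ∈ unitaryUnits (Matrix (Fin 2) (Fin 2) ℂ))
    (hW : mgauge (1 : LSite (F.P K).d → Fin (F.P K).d → (Matrix (Fin 2) (Fin 2) ℂ)ˣ) u₁ W = pull (unitsField (toUField (GaugeField.gaugeAct gJ U))) 0)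
    {lam : LSite (F.P K).d → Matrix (Fin 2) (Fin 2) ℂ} (hsa : ∀ x, IsSelfAdjoint (lam x)) :
    ∀ c ∈ cubeLamB (F.P K).L a M' ρ' (K - n) (K - n) (K - n), ∀ (y : LSite (F.P K).d) (τ : Fin (F.P K).d),
      InBox (loK (F.P K).L (K - n) c.1) (bondHiK (F.P K).L (K - n) c.1 c.2) y →
      InBox (loK (F.P K).L (K - n) c.1) (bondHiK (F.P K).L (K - n) c.1 c.2) (y + e τ) →
        mgauge (1 : LSite (F.P K).d → Fin (F.P K).d → (Matrix (Fin 2) (Fin 2) ℂ)ˣ) (gaugeExp lam)⁻¹ W y τ =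
          gaugeActT (fun s => ((u₁ * gaugeExp lam) (lift (F.P K) x₀ + rel x₀ s))⁻¹ * Unitary.toUnits (suIncl (gJ s)) :
            GaugeTransf (F.P K) 0 (Matrix (Fin 2) (Fin 2) ℂ)ˣ) (unitsField (toUField U)) ⟨cover (F.P K) y, τ⟩ := by
  letI : CStarAlgebra (Matrix (Fin 2) (Fin 2) ℂ) := {}
  intro c hc y τ hy hyτ
  -- the full gauge `u₁·e^{iλ′}` carries the gauge-fixed datum field to `U′`
  have hWV := (datumGuards_gaugeFixed (1 : LSite (F.P K).d → Fin (F.P K).d → (Matrix (Fin 2) (Fin 2) ℂ)ˣ)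
    (pull (unitsField (toUField (GaugeField.gaugeAct gJ U))) 0) W u₁ lam hu₁ hsa hW).2
  -- the bond's ends lie in the top cube `□_k ⊆ □₀`
  have hbox := hbox_cubeLamB (d := (F.P K).d) (F.P K).L a M' ρ' (K - n) (K - n) le_rfl (K - n) le_rfl c hc
  have hkk : cubeFam false (F.P K).L a M' ρ' (K - n) (K - n) = cube (F.P K).L a M' ρ' (K - n) (K - n) := cubeFam_false_of_le _ _ _ _ le_rfl
  have hy0 : y ∈ cube (F.P K).L a M' ρ' (K - n) 0 := cube_anti (Nat.zero_le _) le_rfl (hkk ▸ hbox y hy)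
  have hyτ0 : y + e τ ∈ cube (F.P K).L a M' ρ' (K - n) 0 := cube_anti (Nat.zero_le _) le_rfl (hkk ▸ hbox (y + e τ) hyτ)
  rw [← transl_zero_eq_cover]
  exact (gaugeActT_descent_eq_of_mgauge_cube x₀ ha hroomW U gJ (u₁ * gaugeExp lam) _ hWV hy0 τ hyτ0).symm

end Summit.QuantumFields.YangMills.Theorems.HalvingHSiteTopKnit

end
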